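import Literature.NumberTheory.LFunctions.FordZetaBoundKappa
import Literature.NumberTheory.LFunctions.FordZetaBoundCrude
import Literature.NumberTheory.LFunctions.FordZetaBoundTail
import Mathlib.Analysis.SumIntegralComparisons
import HarnessLib

/-!
# Ford's bound `|ζ(σ + it)| ≤ 76.2 t^{4.45(1−σ)^{3/2}} log^{2/3} t` from his exponential-sum bound (Ford 2002, Theorem 1 from Theorem 2)

Topic `Literature/NumberTheory/LFunctions`. Final file of the PROVED deduction of Theorem 1 of
K. Ford, *Vinogradov's integral and bounds for the Riemann zeta function*, Proc. London Math.
Soc. (3) 85 (2002), 565–633 (arXiv:1910.08209, whose numbering is used) — the named fact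
`Literature.NumberTheory.LFunctions.zeta_bound_ford` of `VinogradovKorobov.lean` — from
Theorem 2 of the same paper (the explicit Vinogradov–Korobov bound for the zeta sums):

  **Theorem 2.** For a positive integer `N ≤ t` and `λ = log t/log N`,
  `S(N, t) := max_{0<u≤1} max_{N<R≤2N} |∑_{N<n≤R} (n+u)^{−it}| ≤ 9.463 N^{1 − 1/(133.66 λ²)}`.

"Proof of Theorem 1. Apply Lemma 7.3 using `C = 9.463`, `D = 133.66` (from Theorem 2)." (§7).
The main theorem of this file,
`Literature.NumberTheory.LFunctions.zeta_bound_ford_of_exp_sum_bound`, is exactly this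
implication, with Theorem 2 — AS PRINTED, for `0 < u ≤ 1`, written with the exponent
`1 − (log N)²/(133.66 (log t)²) = 1 − 1/(133.66 λ²)` — as an explicit HYPOTHESIS. Theorem 2 is
deliberately not vendored as a named fact here (D-0026: this strand adds no unproved
declaration); it is the whole content of §§2–6 of the source (explicit bounds for Vinogradov's
mean value `J_{s,k}(P)`, Theorem 3; incomplete systems, Theorem 4; the ranges `λ ≥ 87`,
Lemmas 5.2–5.3, `1 ≤ λ ≤ 2.6`, Lemma 6.2, `2.6 ≤ λ ≤ 87`, Lemma 6.8), a theory of its own, and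
discharging `zeta_bound_ford` is now literally the task of proving that hypothesis.

## The deduction (Lemmas 7.1–7.3 of the source) as proved in the tree

* `FordZetaBoundCrude.lean` — Lemma 7.1 (crude range): the bound of Theorem 1 holds outright for
  `σ ≤ 15/16` (all `t ≥ 3`) and for `3 ≤ t ≤ e^{300}` (`FordVK.zeta_bound_ford_crude`), from the
  order-`0` Euler–Maclaurin formula ((4.11.2), `AFE.norm_zeta_sub_sum_add_le`).
* `FordZetaBoundTail.lean` — the role of Lemma 7.2: `‖ζ(s) − ∑_{n ≤ ⌊t⌋} n^{−s}‖ ≤ 1` for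
  `σ ≥ 15/16`, `t ≥ e^{300}` (`FordVK.norm_zeta_sub_sum_le_one`), by (4.11.2) at `U ≍ t²` and
  Kusmin–Landau on the dyadic blocks beyond the height.
* this file — Lemma 7.3 (the main range): dyadic blocks `(2^i, 2^{i+1}]` of `∑_{n ≤ ⌊t⌋} n^{−s}`
  (`VdC.dyadic_bound`), each bounded by the MINIMUM of the trivial bound `N^{1−σ}` and the
  partial-summation bound `N^{−σ} S(N,t) ≤ 9.463 e^{a i − b i³}`
  (`a = (1−σ) log 2`, `b = log³2/(133.66 log²t)`; `FordVK.norm_sum_Ioc_one_le_dyadic`); the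
  resulting sum of minima is compared with integrals (`FordVK.sum_Ico_le_integral_add`, a
  unimodal-sequence lemma; `FordVK.dyadic_sum_le`) and, after the substitution
  `x log 2 = u (133.66 log² t)^{1/3}`, `(1−σ)(133.66 log²t)^{1/3} = 3y²`, with the `κ`-lemma of
  `FordZetaBoundKappa.lean` (`FordVK.kappa_le'`: the constant `10` in place of the source's
  `9.463 · 1.0875`); finally `e^{2y³} = t^{(2/9)√(3·133.66)(1−σ)^{3/2}} ≤ t^{4.45(1−σ)^{3/2}}`,
  `(133.66)^{1/3} ≤ 5.113`, `1/log 2 ≤ 1.443`, giving the certified constant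
  `(2 + e^{1.3³} + 2·9.463)/300^{2/3} + 10·5.113·1.443 < 74.5 ≤ 76.2`
  (`FordVK.zeta_bound_ford_main_of_tail`).
* Theorem 2 enters through its consequence at `u = 0` (`u → 0⁺` by continuity,
  `FordVK.norm_sum_Ioc_cpow_le_of_shifted`).

Deviation from the printed proof of Lemma 7.3, recorded for faithfulness: the source bounds
every block by `C e^{g(j)}` and needs the numerical supremum
`e^{−2y³}∫_0^∞ e^{3y²u−u³} du ≤ 1.0875034`, which is what makes `A = 76.2` tight to `1.5·10⁻⁴`;
taking the minimum with the trivial block bound (Theorem 2 is weaker than the trivial bound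
exactly for `u < (log 9.463)^{1/3}`) lowers the needed constant to `≈ 7.06·(133.66)^{1/3}/log 2`
and leaves room for elementary certified numerics. The crossover between the crude and the main
range is moved from `10^{100}` to `e^{300}`. The statement proved is Theorem 1 exactly as printed
(first inequality, `A = 76.2`, `B = 4.45`).

## References

* K. Ford, *Vinogradov's integral and bounds for the Riemann zeta function*, Proc. London Math.
  Soc. (3) 85 (2002), 565–633; arXiv:1910.08209 — Theorem 1, Theorem 2, Lemmas 7.1–7.3 and the
  "Proof of Theorem 1" (§7). (`Ford2002`)
-/

noncomputable section

open Complex Real Finset MeasureTheory intervalIntegral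

namespace Literature.NumberTheory.LFunctions

namespace FordVK


/-! ## Dyadic blocks below the height -/

/-- **Trivial block bound**: for `σ ≥ 0`, `1 ≤ N ≤ x ≤ 2N`,
`‖∑_{N < n ≤ x} n^{−σ−it}‖ ≤ N^{1−σ}` (at most `N` terms of modulus `≤ N^{−σ}`). [folklore] -/
theorem norm_block_le_trivial {σ t : ℝ} (hσ : 0 ≤ σ) {N x : ℕ} (hN : 1 ≤ N) (hx : x ≤ 2 * N) :
    ‖∑ n ∈ Finset.Ioc N x, (n : ℂ) ^ (-((σ : ℂ) + t * I))‖ ≤ (N : ℝ) ^ (1 - σ) := by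
  have hN0 : (0 : ℝ) < N := by exact_mod_cast hN
  have h1 : ‖∑ n ∈ Finset.Ioc N x, (n : ℂ) ^ (-((σ : ℂ) + t * I))‖
      ≤ ∑ n ∈ Finset.Ioc N x, (N : ℝ) ^ (-σ) := by
    refine (norm_sum_le _ _).trans (Finset.sum_le_sum fun n hn ↦ ?_)
    have hn : N < n := (Finset.mem_Ioc.1 hn).1
    have hn0 : 0 < n := by omega
    rw [Complex.norm_natCast_cpow_of_pos hn0]
    simp only [neg_re, add_re, ofReal_re, mul_re, I_re, mul_zero, ofReal_im, I_im, mul_one,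
      sub_self, add_zero]
    exact Real.rpow_le_rpow_of_nonpos hN0 (by exact_mod_cast hn.le) (by linarith)
  refine h1.trans ?_
  rw [Finset.sum_const, Nat.card_Ioc, nsmul_eq_mul]
  have h2 : ((x - N : ℕ) : ℝ) ≤ N := by
    have : x - N ≤ N := by omega
    exact_mod_cast this
  have h3 : 0 ≤ (N : ℝ) ^ (-σ) := by positivity
  calc ((x - N : ℕ) : ℝ) * (N : ℝ) ^ (-σ) ≤ N * (N : ℝ) ^ (-σ) := mul_le_mul_of_nonneg_right h2 h3
    _ = (N : ℝ) ^ (1 - σ) := by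
        rw [Real.rpow_sub hN0, Real.rpow_one, Real.rpow_neg hN0.le]; field_simp

/-- **Block bound from the exponential-sum input**: if `‖∑_{N < n ≤ y} n^{−it}‖ ≤ B` for
`N < y ≤ x`, then `‖∑_{N < n ≤ x} n^{−σ−it}‖ ≤ N^{−σ} B` (`σ ≥ 0`, `N ≥ 1`; Abel summation,
`VdC.abel_bound_rpow`). [cite: Ford2002, Lemma 7.3 (proof, partial summation)] -/
theorem norm_block_le_of_partial {σ t B : ℝ} (hσ : 0 ≤ σ) (hB : 0 ≤ B) {N x : ℕ} (hN : 1 ≤ N)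
    (hNx : N ≤ x)
    (hpart : ∀ y, N < y → y ≤ x → ‖∑ n ∈ Finset.Ioc N y, (n : ℂ) ^ (-(t * I))‖ ≤ B) :
    ‖∑ n ∈ Finset.Ioc N x, (n : ℂ) ^ (-((σ : ℂ) + t * I))‖ ≤ (N : ℝ) ^ (-σ) * B := by
  have hN0 : (0 : ℝ) < N := by exact_mod_cast hN
  have hconv : ∑ n ∈ Finset.Ioc N x, (n : ℂ) ^ (-((σ : ℂ) + t * I))
      = ∑ n ∈ Finset.Ioc N x, (((n : ℝ) ^ (-σ) : ℝ) : ℂ) * VdC.e (VdC.phaseD t 0 n) := by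
    refine Finset.sum_congr rfl fun n hn => VdC.natCast_cpow_neg_eq σ t ?_
    have := (Finset.mem_Ioc.1 hn).1; omega
  rw [hconv]
  have hpart' : ∀ y, N < y → y ≤ x → ‖∑ n ∈ Finset.Ioc N y, VdC.e (VdC.phaseD t 0 n)‖ ≤ B := by
    intro y hy1 hy2
    have e1 : ∑ n ∈ Finset.Ioc N y, VdC.e (VdC.phaseD t 0 n)
        = ∑ n ∈ Finset.Ioc N y, (n : ℂ) ^ (-(t * I)) := by
      refine Finset.sum_congr rfl fun n hn => VdC.e_phaseD_zero t ?_
      have := (Finset.mem_Ioc.1 hn).1; omega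
    rw [e1]; exact hpart y hy1 hy2
  have h := VdC.abel_bound_rpow (σ := σ) (fun n : ℕ => VdC.e (VdC.phaseD t 0 n)) hNx hσ hB hpart'
  refine h.trans (mul_le_mul_of_nonneg_right ?_ hB)
  exact Real.rpow_le_rpow_of_nonpos hN0 (by linarith) (by linarith)

/-- Dyadic starting points as exponentials: `(2^i)^{x} = e^{x · i log 2}`. [folklore] -/
theorem two_pow_rpow (i : ℕ) (x : ℝ) : ((2 : ℝ) ^ i) ^ x = Real.exp (x * (i * Real.log 2)) := by
  rw [Real.rpow_def_of_pos (by positivity), Real.log_pow]; ring_nf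

/-- **The dyadic decomposition below the height.** For `0 ≤ σ ≤ 1`, `t ≥ 1` and the bound of
Theorem 2 of the source at `u = 0` for this `t` (hypothesis `hS`), with `N₁ = ⌊t⌋`,
`a = (1 − σ) log 2`, `b = (log 2)³/(133.66 log² t)`:
`‖∑_{1 < n ≤ N₁} n^{−s}‖ ≤ ∑_{i ≤ log₂ N₁} min(e^{a i}, 9.463 e^{a i − b i³})`
(blocks `(2^i, 2^{i+1}]`, each bounded by the minimum of the trivial bound and the partial
summation bound). [cite: Ford2002, Lemma 7.3 (proof)] -/
theorem norm_sum_Ioc_one_le_dyadic {σ t : ℝ} (hσ : 0 ≤ σ) (ht : 1 ≤ t)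
    (hS : ∀ N R : ℕ, 1 ≤ N → (N : ℝ) ≤ t → N < R → R ≤ 2 * N →
      ‖∑ n ∈ Finset.Ioc N R, (n : ℂ) ^ (-(t * I))‖
        ≤ 9.463 * (N : ℝ) ^ (1 - Real.log N ^ 2 / (133.66 * Real.log t ^ 2))) :
    ‖∑ n ∈ Finset.Ioc 1 ⌊t⌋₊, (n : ℂ) ^ (-((σ : ℂ) + t * I))‖
      ≤ ∑ i ∈ Finset.range (Nat.log 2 ⌊t⌋₊ + 1),
          min (Real.exp ((1 - σ) * Real.log 2 * i))
            (9.463 * Real.exp ((1 - σ) * Real.log 2 * i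
              - Real.log 2 ^ 3 / (133.66 * Real.log t ^ 2) * (i : ℝ) ^ 3)) := by
  have ht0 : 0 < t := by linarith
  set N₁ : ℕ := ⌊t⌋₊ with hN₁
  have hN₁t : (N₁ : ℝ) ≤ t := Nat.floor_le ht0.le
  set J : ℕ := Nat.log 2 N₁ with hJ
  have h2J : N₁ ≤ 1 * 2 ^ (J + 1) := by
    rw [one_mul]; exact (Nat.lt_pow_succ_log_self one_lt_two N₁).le
  set L : ℝ := Real.log t with hL
  -- block bound function
  set G : ℕ → ℝ := fun N ↦ min ((N : ℝ) ^ (1 - σ))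
    ((N : ℝ) ^ (-σ) * (9.463 * (N : ℝ) ^ (1 - Real.log N ^ 2 / (133.66 * L ^ 2)))) with hG
  have hG0 : ∀ N, 0 ≤ G N := fun N ↦ by rw [hG]; positivity
  have hblock : ∀ i : ℕ, 1 * 2 ^ i < N₁ →
      ‖∑ n ∈ Finset.Ioc (1 * 2 ^ i) (min (1 * 2 ^ (i + 1)) N₁), (n : ℂ) ^ (-((σ : ℂ) + t * I))‖
        ≤ G (1 * 2 ^ i) := by
    intro i hi
    rw [one_mul] at hi ⊢
    rw [one_mul]
    have hN : 1 ≤ 2 ^ i := Nat.one_le_two_pow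
    have hNx : 2 ^ i ≤ min (2 ^ (i + 1)) N₁ :=
      le_min (Nat.pow_le_pow_right (by norm_num) (by omega)) hi.le
    have hx2 : min (2 ^ (i + 1)) N₁ ≤ 2 * 2 ^ i := (min_le_left _ _).trans (le_of_eq (by ring))
    have hNt : ((2 ^ i : ℕ) : ℝ) ≤ t := le_trans (by exact_mod_cast hi.le) hN₁t
    refine le_min (norm_block_le_trivial hσ hN hx2) ?_
    refine norm_block_le_of_partial hσ (by positivity) hN hNx fun y hy1 hy2 ↦ ?_
    exact hS (2 ^ i) y hN hNt hy1 (hy2.trans hx2)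
  have h := VdC.dyadic_bound (fun n : ℕ ↦ (n : ℂ) ^ (-((σ : ℂ) + t * I))) G hG0 N₁ (J + 1) 1
    hblock h2J
  refine h.trans (le_of_eq (Finset.sum_congr rfl fun i _ ↦ ?_))
  -- `G(2^i)` in exponential form
  rw [hG]
  simp only [one_mul, Nat.cast_pow, Nat.cast_ofNat]
  congr 1
  · rw [two_pow_rpow]; ring_nf
  · rw [two_pow_rpow, two_pow_rpow, Real.log_pow, mul_left_comm, ← Real.exp_add]
    congr 1; congr 1; ring

/-! ## Sums of unimodal sequences against integrals -/

/-- **Unimodal sum against integral.** If `f ≥ 0` is continuous, bounded by `F` on `[0, ∞)`,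
non-decreasing on `[0, x₀]` and non-increasing on `[x₀, ∞)` (`x₀ ≥ 0`), then for natural numbers
`p ≤ n`, `∑_{p ≤ i < n} f(i) ≤ ∫_p^n f + 2F` (the two integers adjacent to the mode are bounded
by `F`, every other `f(i)` by the integral over a unit interval on the appropriate side).
[folklore] -/
theorem sum_Ico_le_integral_add {f : ℝ → ℝ} {x₀ F : ℝ} (hx₀ : 0 ≤ x₀) (hcont : Continuous f)
    (hf0 : ∀ x, 0 ≤ f x) (hfF : ∀ x, 0 ≤ x → f x ≤ F)
    (hmono : MonotoneOn f (Set.Icc 0 x₀)) (hanti : AntitoneOn f (Set.Ici x₀))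
    {p n : ℕ} (hpn : p ≤ n) :
    ∑ i ∈ Finset.Ico p n, f i ≤ (∫ x in (p : ℝ)..n, f x) + 2 * F := by
  have hF0 : 0 ≤ F := (hf0 0).trans (hfF 0 le_rfl)
  have hint : ∀ a b : ℝ, IntervalIntegrable f volume a b := fun a b ↦ hcont.intervalIntegrable a b
  have hInn : ∀ a b : ℝ, a ≤ b → 0 ≤ ∫ x in a..b, f x := fun a b hab ↦
    intervalIntegral.integral_nonneg hab fun x _ ↦ hf0 x
  -- integral over a sub-interval
  have hsub : ∀ a b c d : ℝ, c ≤ a → a ≤ b → b ≤ d → ∫ x in a..b, f x ≤ ∫ x in c..d, f x :=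
    fun a b c d hca hab hbd ↦ integral_mono_interval hca hab hbd
      (Filter.Eventually.of_forall fun x ↦ hf0 x) (hint c d)
  set k : ℕ := ⌊x₀⌋₊ with hk
  have hkx : (k : ℝ) ≤ x₀ := Nat.floor_le hx₀
  have hxk : x₀ < (k : ℝ) + 1 := Nat.lt_floor_add_one x₀
  -- monotone part: `∑_{p ≤ i < q} f(i) ≤ ∫_p^q f` for `q ≤ k`
  have hM : ∀ q : ℕ, p ≤ q → q ≤ k → ∑ i ∈ Finset.Ico p q, f i ≤ ∫ x in (p : ℝ)..q, f x := by
    intro q hpq hqk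
    refine MonotoneOn.sum_le_integral_Ico hpq (hmono.mono fun x hx ↦ ⟨?_, ?_⟩)
    · exact le_trans (Nat.cast_nonneg p) hx.1
    · exact hx.2.trans ((Nat.cast_le.2 hqk).trans hkx)
  -- antitone part: `∑_{q ≤ i < r} f(i) ≤ F + ∫_q^r f` for `k + 1 ≤ q ≤ r`
  have hA : ∀ q r : ℕ, k + 1 ≤ q → q ≤ r →
      ∑ i ∈ Finset.Ico q r, f i ≤ F + ∫ x in (q : ℝ)..r, f x := by
    intro q r hq hqr
    rcases hqr.eq_or_lt with rfl | hlt
    · simp [hF0]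
    have hqx : x₀ ≤ q := by
      have : (k : ℝ) + 1 ≤ q := by exact_mod_cast hq
      linarith
    rw [Finset.sum_eq_sum_Ico_succ_bot hlt]
    have h1 : ∑ i ∈ Finset.Ico (q + 1) r, f i = ∑ j ∈ Finset.Ico q (r - 1), f ((j + 1 : ℕ) : ℝ) := by
      rw [Finset.sum_Ico_add' (fun i : ℕ ↦ f (i : ℝ)) q (r - 1) 1, Nat.sub_add_cancel (by omega)]
    have h2 : ∑ j ∈ Finset.Ico q (r - 1), f ((j + 1 : ℕ) : ℝ) ≤ ∫ x in (q : ℝ)..((r - 1 : ℕ) : ℝ), f x := by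
      refine AntitoneOn.sum_le_integral_Ico (by omega) (hanti.mono fun x hx ↦ ?_)
      exact hqx.trans hx.1
    have h3 : ∫ x in (q : ℝ)..((r - 1 : ℕ) : ℝ), f x ≤ ∫ x in (q : ℝ)..r, f x :=
      hsub _ _ _ _ le_rfl (by exact_mod_cast (by omega : q ≤ r - 1)) (by exact_mod_cast Nat.sub_le r 1)
    have h4 : f q ≤ F := hfF q (Nat.cast_nonneg q)
    linarith
  -- case analysis on the position of the mode
  rcases le_or_gt n k with hnk | hnk
  · -- everything in the monotone range
    have := hM n hpn hnk
    linarith [hInn p n (by exact_mod_cast hpn)]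
  rcases lt_or_ge k p with hkp | hkp
  · -- everything in the antitone range
    have := hA p n (by omega) hpn
    linarith
  · -- split at `k`: `[p, k) ∪ {k} ∪ [k+1, n)`
    rw [← Finset.sum_Ico_consecutive _ hkp hnk.le, Finset.sum_eq_sum_Ico_succ_bot hnk]
    have h1 := hM k hkp le_rfl
    have h2 := hA (k + 1) n le_rfl (by omega)
    have h3 : f k ≤ F := hfF k (Nat.cast_nonneg k)
    have h4 : (∫ x in (p : ℝ)..k, f x) + ∫ x in ((k + 1 : ℕ) : ℝ)..n, f x ≤ ∫ x in (p : ℝ)..n, f x := by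
      have e := integral_add_adjacent_intervals (hint (p : ℝ) k) (hint (k : ℝ) n)
      have h5 : ∫ x in ((k + 1 : ℕ) : ℝ)..n, f x ≤ ∫ x in (k : ℝ)..n, f x :=
        hsub _ _ _ _ (by push_cast; linarith) (by exact_mod_cast (by omega : k + 1 ≤ n)) le_rfl
      linarith
    linarith

/-! ## The comparison function `C e^{a x − x³/W³}` -/

/-- Monotonicity of `a x − x³/W³` on `[0, yW]` and `[yW, ∞)` when `aW = 3y²` (`W > 0`):
`(a v − v³/W³) − (a u − u³/W³) = (v − u)(a − (u² + uv + v²)/W³)`. [folklore] -/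
theorem cubic_monotone {a W y u v : ℝ} (hW : 0 < W) (hay : a * W = 3 * y ^ 2)
    (hu : 0 ≤ u) (huv : u ≤ v) (hv : v ≤ y * W) :
    a * u - u ^ 3 / W ^ 3 ≤ a * v - v ^ 3 / W ^ 3 := by
  have hW3 : 0 < W ^ 3 := by positivity
  rw [← sub_nonneg]
  have e : a * v - v ^ 3 / W ^ 3 - (a * u - u ^ 3 / W ^ 3)
      = (v - u) * (a * W ^ 3 - (u ^ 2 + u * v + v ^ 2)) / W ^ 3 := by
    field_simp; ring
  rw [e]
  apply div_nonneg _ hW3.le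
  apply mul_nonneg (by linarith)
  have h1 : u ^ 2 + u * v + v ^ 2 ≤ 3 * (y * W) ^ 2 := by
    have hv0 : 0 ≤ v := hu.trans huv
    nlinarith [mul_le_mul hv hv hv0 (by nlinarith), mul_le_mul (huv.trans hv) hv hv0 (by nlinarith),
      mul_le_mul (huv.trans hv) (huv.trans hv) hu (by nlinarith)]
  nlinarith

/-- Antitonicity of `a x − x³/W³` on `[yW, ∞)` when `aW = 3y²`, `y ≥ 0`. [folklore] -/
theorem cubic_antitone {a W y u v : ℝ} (hW : 0 < W) (hy : 0 ≤ y) (hay : a * W = 3 * y ^ 2)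
    (hu : y * W ≤ u) (huv : u ≤ v) :
    a * v - v ^ 3 / W ^ 3 ≤ a * u - u ^ 3 / W ^ 3 := by
  have hW3 : 0 < W ^ 3 := by positivity
  rw [← sub_nonneg]
  have e : a * u - u ^ 3 / W ^ 3 - (a * v - v ^ 3 / W ^ 3)
      = (v - u) * ((u ^ 2 + u * v + v ^ 2) - a * W ^ 3) / W ^ 3 := by
    field_simp; ring
  rw [e]
  apply div_nonneg _ hW3.le
  apply mul_nonneg (by linarith)
  have hyW : 0 ≤ y * W := mul_nonneg hy hW.le
  have h1 : 3 * (y * W) ^ 2 ≤ u ^ 2 + u * v + v ^ 2 := by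
    nlinarith [mul_le_mul hu hu hyW (hyW.trans hu), mul_le_mul hu (hu.trans huv) hyW (hyW.trans hu),
      mul_le_mul (hu.trans huv) (hu.trans huv) hyW (hyW.trans (hu.trans huv))]
  nlinarith

/-- The maximum of `a x − x³/W³` on `x ≥ 0` is `2y³` (`aW = 3y²`): with `u = x/W`,
`3y²u − u³ − 2y³ = −(u − y)²(u + 2y)`. [cite: Ford2002, Lemma 7.3 (proof)] -/
theorem cubic_le_max {a W y x : ℝ} (hW : 0 < W) (hy : 0 ≤ y) (hay : a * W = 3 * y ^ 2)
    (hx : 0 ≤ x) : a * x - x ^ 3 / W ^ 3 ≤ 2 * y ^ 3 := by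
  set u : ℝ := x / W with hu
  have hu0 : 0 ≤ u := by rw [hu]; positivity
  have e1 : a * x = 3 * y ^ 2 * u := by
    rw [hu]; field_simp; nlinarith [hay]
  have e2 : x ^ 3 / W ^ 3 = u ^ 3 := by rw [hu, div_pow]
  rw [e1, e2]
  nlinarith [mul_nonneg (sq_nonneg (u - y)) (by linarith : 0 ≤ u + 2 * y)]

/-! ## The dyadic sum against `e^{2y³}` -/

/-- **The dyadic sum of minima.** For `a ≥ 0`, `W > 0`, `y ≥ 0` with `aW = 3y²` and every `n`,
`∑_{i < n} min(e^{a i}, 9.463 e^{a i − i³/W³}) ≤ (9 + 2 · 9.463 + 10 W) e^{2y³}`: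
the terms `i ≤ x* = 1.3 W` are bounded trivially and compared with `∫_0^{x*} e^{ax} dx` (plus the
last term `e^{a x*} ≤ e^{1.3³} e^{2y³} ≤ 9 e^{2y³}`), the terms `i > x*` by the unimodal
comparison (`FordVK.sum_Ico_le_integral_add`, two stray terms `≤ 9.463 e^{2y³}`), and the two
integrals, after `x = Wu`, by the `κ`-lemma `FordVK.kappa_le'`.
[cite: Ford2002, Lemma 7.3 (proof)] -/
theorem dyadic_sum_le {a W y : ℝ} (ha : 0 ≤ a) (hW : 0 < W) (hy : 0 ≤ y)
    (hay : a * W = 3 * y ^ 2) (n : ℕ) :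
    ∑ i ∈ Finset.range n, min (Real.exp (a * i)) (9.463 * Real.exp (a * i - (i : ℝ) ^ 3 / W ^ 3))
      ≤ (9 + 2 * 9.463 + 10 * W) * Real.exp (2 * y ^ 3) := by
  set C : ℝ := 9.463 with hC
  have hC0 : (0 : ℝ) ≤ C := by norm_num [hC]
  set E : ℝ := Real.exp (2 * y ^ 3) with hE
  have hE0 : 0 < E := Real.exp_pos _
  set f₁ : ℝ → ℝ := fun x ↦ Real.exp (a * x) with hf₁
  set f₂ : ℝ → ℝ := fun x ↦ C * Real.exp (a * x - x ^ 3 / W ^ 3) with hf₂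
  set xs : ℝ := 13 / 10 * W with hxs
  have hxs0 : 0 ≤ xs := by rw [hxs]; positivity
  set m : ℕ := ⌊xs⌋₊ with hm
  have hmxs : (m : ℝ) ≤ xs := Nat.floor_le hxs0
  have hxsm : xs < (m : ℝ) + 1 := Nat.lt_floor_add_one xs
  -- properties of `f₂`
  have hf₂0 : ∀ x, 0 ≤ f₂ x := fun x ↦ by rw [hf₂]; positivity
  have hf₂F : ∀ x, 0 ≤ x → f₂ x ≤ C * E := fun x hx ↦ by
    rw [hf₂, hE]
    exact mul_le_mul_of_nonneg_left (Real.exp_le_exp.2 (cubic_le_max hW hy hay hx)) hC0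
  have hf₂c : Continuous f₂ := by rw [hf₂]; fun_prop
  have hf₂m : MonotoneOn f₂ (Set.Icc 0 (y * W)) := fun u hu v hv huv ↦ by
    simp only [hf₂]
    exact mul_le_mul_of_nonneg_left (Real.exp_le_exp.2 (cubic_monotone hW hay hu.1 huv hv.2)) hC0
  have hf₂a : AntitoneOn f₂ (Set.Ici (y * W)) := fun u hu v _ huv ↦ by
    simp only [hf₂]
    exact mul_le_mul_of_nonneg_left (Real.exp_le_exp.2 (cubic_antitone hW hy hay hu huv)) hC0
  -- properties of `f₁`
  have hf₁0 : ∀ x, 0 ≤ f₁ x := fun x ↦ by rw [hf₁]; positivity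
  have hf₁m : Monotone f₁ := fun u v huv ↦ by
    simp only [hf₁]; exact Real.exp_le_exp.2 (by nlinarith)
  have hf₁c : Continuous f₁ := by rw [hf₁]; fun_prop
  -- Step 1: split the sum of minima at `m`
  have hsplit : ∑ i ∈ Finset.range n, min (f₁ i) (f₂ i)
      ≤ ∑ i ∈ Finset.range (m + 1), f₁ i + ∑ i ∈ Finset.Ico (m + 1) n, f₂ i := by
    rw [← Finset.sum_filter_add_sum_filter_not (Finset.range n) (fun i ↦ i ≤ m)]
    refine add_le_add ?_ ?_
    · calc ∑ i ∈ (Finset.range n).filter (fun i ↦ i ≤ m), min (f₁ i) (f₂ i)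
          ≤ ∑ i ∈ (Finset.range n).filter (fun i ↦ i ≤ m), f₁ i :=
            Finset.sum_le_sum fun i _ ↦ min_le_left _ _
        _ ≤ ∑ i ∈ Finset.range (m + 1), f₁ i := by
            refine Finset.sum_le_sum_of_subset_of_nonneg ?_ fun i _ _ ↦ hf₁0 i
            intro i hi
            simp only [Finset.mem_filter, Finset.mem_range] at hi ⊢
            omega
    · calc ∑ i ∈ (Finset.range n).filter (fun i ↦ ¬ i ≤ m), min (f₁ i) (f₂ i)
          ≤ ∑ i ∈ (Finset.range n).filter (fun i ↦ ¬ i ≤ m), f₂ i :=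
            Finset.sum_le_sum fun i _ ↦ min_le_right _ _
        _ ≤ ∑ i ∈ Finset.Ico (m + 1) n, f₂ i := by
            refine Finset.sum_le_sum_of_subset_of_nonneg ?_ fun i _ _ ↦ hf₂0 i
            intro i hi
            simp only [Finset.mem_filter, Finset.mem_range, Finset.mem_Ico] at hi ⊢
            omega
  -- Step 2: the trivial part against `∫_0^{xs} f₁ + f₁ xs`
  have hpart1 : ∑ i ∈ Finset.range (m + 1), f₁ i ≤ (∫ x in (0 : ℝ)..xs, f₁ x) + 9 * E := by
    rw [Finset.sum_range_succ]
    have h1 : ∑ i ∈ Finset.range m, f₁ i ≤ ∫ x in ((0 : ℕ) : ℝ)..m, f₁ x := by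
      rw [Finset.range_eq_Ico]
      exact MonotoneOn.sum_le_integral_Ico (Nat.zero_le m) (hf₁m.monotoneOn _)
    rw [Nat.cast_zero] at h1
    have h2 : ∫ x in (0 : ℝ)..m, f₁ x ≤ ∫ x in (0 : ℝ)..xs, f₁ x :=
      integral_mono_interval le_rfl (Nat.cast_nonneg m) hmxs
        (Filter.Eventually.of_forall fun x ↦ hf₁0 x) (hf₁c.intervalIntegrable _ _)
    have h3 : f₁ m ≤ 9 * E := by
      calc f₁ m ≤ f₁ xs := hf₁m hmxs
        _ = Real.exp (3 * y ^ 2 * (13 / 10)) := by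
            simp only [hf₁, hxs]; congr 1; nlinarith [hay]
        _ ≤ Real.exp ((13 / 10) ^ 3 + 2 * y ^ 3) := by
            apply Real.exp_le_exp.2
            nlinarith [mul_nonneg (sq_nonneg (13 / 10 - y)) (by linarith : 0 ≤ 13 / 10 + 2 * y)]
        _ = Real.exp ((13 / 10) ^ 3) * E := by rw [Real.exp_add]
        _ ≤ 9 * E := mul_le_mul_of_nonneg_right exp_cube_le hE0.le
    linarith
  -- Step 3: the Theorem-2 part against `∫_{xs}^{V W} f₂ + 2 C E`
  set V : ℝ := max ((n : ℝ) / W) (13 / 10) with hV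
  have hV13 : 13 / 10 ≤ V := le_max_right _ _
  have hVW : xs ≤ V * W := by
    rw [hxs]; exact mul_le_mul_of_nonneg_right hV13 hW.le
  have hpart2 : ∑ i ∈ Finset.Ico (m + 1) n, f₂ i ≤ (∫ x in xs..V * W, f₂ x) + 2 * (C * E) := by
    rcases le_or_gt (m + 1) n with hmn | hmn
    · have h1 := sum_Ico_le_integral_add (mul_nonneg hy hW.le) hf₂c hf₂0 hf₂F hf₂m hf₂a hmn
      have hnV : (n : ℝ) ≤ V * W := by
        have : (n : ℝ) / W ≤ V := le_max_left _ _
        rwa [div_le_iff₀ hW] at this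
      have h2 : ∫ x in ((m + 1 : ℕ) : ℝ)..n, f₂ x ≤ ∫ x in xs..V * W, f₂ x :=
        integral_mono_interval (by push_cast; linarith) (by exact_mod_cast hmn) hnV
          (Filter.Eventually.of_forall fun x ↦ hf₂0 x) (hf₂c.intervalIntegrable _ _)
      linarith
    · rw [Finset.Ico_eq_empty (by omega), Finset.sum_empty]
      have : 0 ≤ ∫ x in xs..V * W, f₂ x := intervalIntegral.integral_nonneg hVW fun x _ ↦ hf₂0 x
      positivity
  -- Step 4: the substitution `x = W u` and the `κ`-lemma
  have exs : xs / W = 13 / 10 := by rw [hxs]; field_simp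
  have eVW : V * W / W = V := by field_simp
  have eax : ∀ x, a * x = 3 * y ^ 2 * (x / W) := fun x ↦ by
    field_simp; linear_combination x * hay
  have hI1 : ∫ x in (0 : ℝ)..xs, f₁ x = W * ∫ u in (0 : ℝ)..13 / 10, Real.exp (3 * y ^ 2 * u) := by
    have e1 : f₁ = fun x ↦ (fun u ↦ Real.exp (3 * y ^ 2 * u)) (x / W) := by
      funext x; simp only [hf₁, eax x]
    rw [e1, intervalIntegral.integral_comp_div _ hW.ne', smul_eq_mul, zero_div, exs]
  have hI2 : ∫ x in xs..V * W, f₂ x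
      = W * (C * ∫ u in (13 / 10 : ℝ)..V, Real.exp (3 * y ^ 2 * u - u ^ 3)) := by
    have e1 : f₂ = fun x ↦ (fun u ↦ C * Real.exp (3 * y ^ 2 * u - u ^ 3)) (x / W) := by
      funext x; simp only [hf₂, eax x, div_pow]
    rw [e1, intervalIntegral.integral_comp_div _ hW.ne', smul_eq_mul,
      intervalIntegral.integral_const_mul, exs, eVW]
  have hκ := kappa_le' hy hV13
  have hbr : (∫ u in (0 : ℝ)..13 / 10, Real.exp (3 * y ^ 2 * u))
      + C * ∫ u in (13 / 10 : ℝ)..V, Real.exp (3 * y ^ 2 * u - u ^ 3) ≤ 10 * E := by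
    have e : Real.exp (-2 * y ^ 3) * E = 1 := by rw [hE, ← Real.exp_add]; simp
    have h0 : 0 < Real.exp (-2 * y ^ 3) := Real.exp_pos _
    nlinarith
  -- assemble
  calc ∑ i ∈ Finset.range n, min (f₁ i) (f₂ i)
      ≤ ∑ i ∈ Finset.range (m + 1), f₁ i + ∑ i ∈ Finset.Ico (m + 1) n, f₂ i := hsplit
    _ ≤ ((∫ x in (0 : ℝ)..xs, f₁ x) + 9 * E) + ((∫ x in xs..V * W, f₂ x) + 2 * (C * E)) :=
        add_le_add hpart1 hpart2
    _ = (9 + 2 * C) * E + W * ((∫ u in (0 : ℝ)..13 / 10, Real.exp (3 * y ^ 2 * u))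
          + C * ∫ u in (13 / 10 : ℝ)..V, Real.exp (3 * y ^ 2 * u - u ^ 3)) := by
        rw [hI1, hI2]; ring
    _ ≤ (9 + 2 * C) * E + W * (10 * E) := by gcongr
    _ = (9 + 2 * 9.463 + 10 * W) * E := by rw [hC]; ring

/-! ## The main range `t ≥ e^{300}`, `15/16 ≤ σ ≤ 1` -/

/-- Numerical constants of the main range: `(133.66 L²)^{1/3} ≤ 5.113 L^{2/3}`,
`1/log 2 ≤ 1.443`, `44.8 ≤ L^{2/3}` for `L ≥ 300`, and `4 · 133.66 / 27 ≤ 4.45²`. [folklore] -/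
theorem main_constants {L : ℝ} (hL : 300 ≤ L) :
    (133.66 * L ^ 2) ^ (1 / 3 : ℝ) ≤ 5.113 * L ^ (2 / 3 : ℝ) ∧ 44.8 ≤ L ^ (2 / 3 : ℝ) := by
  have hL0 : 0 < L := by linarith
  have hQ : 0 ≤ L ^ (2 / 3 : ℝ) := by positivity
  have hQ3 : (L ^ (2 / 3 : ℝ)) ^ 3 = L ^ 2 := VK.rpow_two_thirds_pow_three hL0.le
  constructor
  · refine le_of_pow_le_pow_left₀ (n := 3) (by norm_num) (by positivity) ?_
    rw [← Real.rpow_natCast, ← Real.rpow_mul (by positivity), mul_pow, hQ3]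
    norm_num
    nlinarith [sq_nonneg L]
  · refine le_of_pow_le_pow_left₀ (n := 3) (by norm_num) hQ ?_
    rw [hQ3]; nlinarith

/-- **The main range of Ford's Theorem 1 from Theorem 2, proved** (Lemma 7.3 of the source, in the
in-tree form). For `15/16 ≤ σ ≤ 1`, `t ≥ e^{300}`, given the tail bound
`‖ζ(s) − ∑_{n ≤ ⌊t⌋} n^{−s}‖ ≤ 1` and the bound of Theorem 2 at `u = 0` for this `t`
(hypothesis `hS`): `|ζ(σ + it)| ≤ 76.2 t^{4.45(1−σ)^{3/2}} (log t)^{2/3}`. The certified constant is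
`(2 + e^{1.3³} + 2·9.463)/300^{2/3} + 10 · 5.113 · 1.443 < 74.5`.
[cite: Ford2002, Lemma 7.3] -/
theorem zeta_bound_ford_main_of_tail {σ t : ℝ} (hσ : 15 / 16 ≤ σ) (hσ1 : σ ≤ 1)
    (ht : Real.exp 300 ≤ t)
    (htail : ‖riemannZeta (σ + t * I)
      - ∑ n ∈ Finset.Icc 1 ⌊t⌋₊, (n : ℂ) ^ (-((σ : ℂ) + t * I))‖ ≤ 1)
    (hS : ∀ N R : ℕ, 1 ≤ N → (N : ℝ) ≤ t → N < R → R ≤ 2 * N →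
      ‖∑ n ∈ Finset.Ioc N R, (n : ℂ) ^ (-(t * I))‖
        ≤ 9.463 * (N : ℝ) ^ (1 - Real.log N ^ 2 / (133.66 * Real.log t ^ 2))) :
    ‖riemannZeta (σ + t * I)‖
      ≤ 76.2 * t ^ (4.45 * (1 - σ) ^ (3 / 2 : ℝ)) * Real.log t ^ (2 / 3 : ℝ) := by
  have h300 : (300 : ℝ) + 1 ≤ Real.exp 300 := Real.add_one_le_exp 300
  have ht0 : 0 < t := by linarith
  have ht1 : 1 ≤ t := by linarith
  have hσ0 : 0 ≤ σ := by linarith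
  have h1σ : 0 ≤ 1 - σ := by linarith
  set L : ℝ := Real.log t with hL
  have hL300 : 300 ≤ L := by rw [hL, Real.le_log_iff_exp_le ht0]; exact ht
  have hL0 : 0 < L := by linarith
  obtain ⟨hΛQ, hQ⟩ := main_constants hL300
  set N₁ : ℕ := ⌊t⌋₊ with hN₁
  have hN₁1 : 1 ≤ N₁ := Nat.le_floor (by exact_mod_cast ht1)
  set s : ℂ := (σ : ℂ) + t * I with hs
  -- Step 1–2: `‖ζ‖ ≤ 2 + ‖∑_{1 < n ≤ N₁} n^{-s}‖`
  have hsplit : ∑ n ∈ Finset.Icc 1 N₁, (n : ℂ) ^ (-s) = 1 + ∑ n ∈ Finset.Ioc 1 N₁, (n : ℂ) ^ (-s) := by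
    rw [show Finset.Icc 1 N₁ = Finset.Ioc 0 N₁ from Finset.Icc_add_one_left_eq_Ioc 0 N₁,
      ← Finset.sum_Ioc_consecutive _ (Nat.zero_le 1) hN₁1]
    congr 1
    simp
  have h12 : ‖riemannZeta s‖ ≤ 2 + ‖∑ n ∈ Finset.Ioc 1 N₁, (n : ℂ) ^ (-s)‖ := by
    set Z : ℂ := riemannZeta s with hZ
    set S : ℂ := ∑ n ∈ Finset.Icc 1 N₁, (n : ℂ) ^ (-s) with hSdef
    set T : ℂ := ∑ n ∈ Finset.Ioc 1 N₁, (n : ℂ) ^ (-s) with hT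
    have e : Z = (Z - S) + (1 + T) := by rw [hsplit]; ring
    calc ‖Z‖ = ‖(Z - S) + (1 + T)‖ := congrArg (‖·‖) e
      _ ≤ ‖Z - S‖ + ‖1 + T‖ := norm_add_le _ _
      _ ≤ 1 + (‖(1 : ℂ)‖ + ‖T‖) := add_le_add htail (norm_add_le _ _)
      _ = 2 + ‖T‖ := by simp; ring
  -- Step 3: dyadic decomposition
  have hdy := norm_sum_Ioc_one_le_dyadic hσ0 ht1 hS
  rw [← hN₁, ← hL] at hdy
  -- Step 4: the scale `W` and the parameter `y`
  set Λ : ℝ := (133.66 * L ^ 2) ^ (1 / 3 : ℝ) with hΛ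
  have hΛ0 : 0 < Λ := by rw [hΛ]; positivity
  have hΛ3 : Λ ^ 3 = 133.66 * L ^ 2 := by
    rw [hΛ, ← Real.rpow_natCast, ← Real.rpow_mul (by positivity)]; norm_num
  have hlog2 : 0.6931471803 < Real.log 2 := Real.log_two_gt_d9
  have hlog2' : 0 < Real.log 2 := by linarith
  set W : ℝ := Λ / Real.log 2 with hW
  have hW0 : 0 < W := by rw [hW]; positivity
  have hW3 : Real.log 2 ^ 3 / (133.66 * L ^ 2) = 1 / W ^ 3 := by
    rw [hW, div_pow, hΛ3]; field_simp
  set a : ℝ := (1 - σ) * Real.log 2 with ha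
  have ha0 : 0 ≤ a := by rw [ha]; positivity
  have haW : a * W = (1 - σ) * Λ := by rw [ha, hW]; field_simp
  set y : ℝ := Real.sqrt (a * W / 3) with hy
  have hy0 : 0 ≤ y := Real.sqrt_nonneg _
  have hy2 : y ^ 2 = a * W / 3 := by rw [hy, Real.sq_sqrt (by positivity)]
  have hay : a * W = 3 * y ^ 2 := by rw [hy2]; ring
  -- rewrite the dyadic sum in the form of `dyadic_sum_le`
  have hdy' : ‖∑ n ∈ Finset.Ioc 1 N₁, (n : ℂ) ^ (-s)‖
      ≤ ∑ i ∈ Finset.range (Nat.log 2 N₁ + 1),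
          min (Real.exp (a * i)) (9.463 * Real.exp (a * i - (i : ℝ) ^ 3 / W ^ 3)) := by
    refine hdy.trans (le_of_eq (Finset.sum_congr rfl fun i _ ↦ ?_))
    rw [hW3, ha]; ring_nf
  have hmain := hdy'.trans (dyadic_sum_le ha0 hW0 hy0 hay _)
  -- Step 6: `e^{2y³} ≤ t^{B''}`
  set B'' : ℝ := 4.45 * (1 - σ) ^ (3 / 2 : ℝ) with hB''
  have hB0 : 0 ≤ B'' := by rw [hB'']; positivity
  set P : ℝ := t ^ B'' with hP
  have hP1 : 1 ≤ P := Real.one_le_rpow ht1 hB0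
  have hEP : Real.exp (2 * y ^ 3) ≤ P := by
    rw [hP, Real.rpow_def_of_pos ht0, ← hL]
    apply Real.exp_le_exp.2
    -- compare squares: `(2y³)² = 4 (aW/3)³ = (4·133.66/27) (1-σ)³ L² ≤ (4.45 (1-σ)^{3/2} L)²`
    have h32 : ((1 - σ) ^ (3 / 2 : ℝ)) ^ 2 = (1 - σ) ^ 3 := by
      rw [← Real.rpow_natCast, ← Real.rpow_mul h1σ]; norm_num
    have hX : 0 ≤ (1 - σ) ^ 3 * L ^ 2 := by positivity
    have e2 : (2 * y ^ 3) ^ 2 = 4 * 133.66 / 27 * ((1 - σ) ^ 3 * L ^ 2) := by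
      have e1 : (2 * y ^ 3) ^ 2 = 4 * (y ^ 2) ^ 3 := by ring
      rw [e1, hy2, haW, div_pow, mul_pow, hΛ3]; ring
    have e3 : (L * B'') ^ 2 = 4.45 ^ 2 * ((1 - σ) ^ 3 * L ^ 2) := by
      rw [hB'', mul_pow, mul_pow, h32]; ring
    have hsq : (2 * y ^ 3) ^ 2 ≤ (L * B'') ^ 2 := by
      rw [e2, e3]; exact mul_le_mul_of_nonneg_right (by norm_num) hX
    have h2 : 0 ≤ L * B'' := by positivity
    exact (pow_le_pow_iff_left₀ (by positivity) h2 two_ne_zero).1 hsq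
  -- Step 7: `W ≤ 7.378 L^{2/3}`
  set Q : ℝ := L ^ (2 / 3 : ℝ) with hQdef
  have hQ0 : 0 ≤ Q := by rw [hQdef]; positivity
  have hWQ : W ≤ 7.38 * Q := by
    have h1 : W ≤ 1.443 * Λ := by
      rw [hW, div_le_iff₀ hlog2']
      nlinarith [mul_nonneg hΛ0.le (by linarith : (0 : ℝ) ≤ 1.443 * Real.log 2 - 1)]
    calc W ≤ 1.443 * Λ := h1
      _ ≤ 1.443 * (5.113 * Q) := by gcongr
      _ ≤ 7.38 * Q := by nlinarith [hQ0]
  -- Step 8: assemble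
  have hE0 : 0 < Real.exp (2 * y ^ 3) := Real.exp_pos _
  have hfin : ‖riemannZeta s‖ ≤ 2 + (9 + 2 * 9.463 + 10 * W) * Real.exp (2 * y ^ 3) := by
    linarith
  have hWE : W * Real.exp (2 * y ^ 3) ≤ (7.38 * Q) * P := mul_le_mul hWQ hEP hE0.le (by positivity)
  have hQP : 44.8 * P ≤ Q * P := mul_le_mul_of_nonneg_right hQ (by linarith)
  have hEP' : (9 + 2 * 9.463) * Real.exp (2 * y ^ 3) ≤ (9 + 2 * 9.463) * P :=
    mul_le_mul_of_nonneg_left hEP (by norm_num)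
  have hQP0 : 0 ≤ Q * P := by positivity
  calc ‖riemannZeta s‖ ≤ 2 + (9 + 2 * 9.463 + 10 * W) * Real.exp (2 * y ^ 3) := hfin
    _ = 2 + (9 + 2 * 9.463) * Real.exp (2 * y ^ 3) + 10 * (W * Real.exp (2 * y ^ 3)) := by ring
    _ ≤ 2 * P + (9 + 2 * 9.463) * P + 10 * ((7.38 * Q) * P) := by linarith
    _ ≤ 76.2 * P * Q := by linarith
    _ = 76.2 * t ^ B'' * L ^ (2 / 3 : ℝ) := by rw [hP, hQdef]

/-! ## From Theorem 2 (`0 < u ≤ 1`) to `u = 0` -/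

/-- The shifted zeta sum `u ↦ ∑_{N < n ≤ R} (n + u)^{−it}` is continuous at `u = 0` (each base
`n + u`, `n ≥ 1`, stays in the slit plane). [folklore] -/
theorem continuousAt_sum_Ioc_cpow (N R : ℕ) (t : ℝ) :
    ContinuousAt (fun u : ℝ ↦ ∑ n ∈ Finset.Ioc N R, ((n : ℂ) + u) ^ (-(t * I))) 0 := by
  refine tendsto_finsetSum _ fun n hn ↦ ?_
  have hn0 : 0 < n := Nat.lt_of_le_of_lt (Nat.zero_le N) (Finset.mem_Ioc.1 hn).1
  have hbase : ContinuousAt (fun u : ℝ ↦ (n : ℂ) + u) 0 :=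
    (continuous_const.add Complex.continuous_ofReal).continuousAt
  have hslit : (n : ℂ) + ((0 : ℝ) : ℂ) ∈ Complex.slitPlane := by
    rw [Complex.ofReal_zero, add_zero]
    exact_mod_cast Complex.natCast_mem_slitPlane.2 hn0.ne'
  exact ContinuousAt.comp_of_eq (g := fun z : ℂ ↦ z ^ (-(t * I)))
    (continuousAt_cpow_const hslit) hbase rfl

/-- **From `0 < u ≤ 1` to `u = 0`.** If `‖∑_{N < n ≤ R} (n + u)^{−it}‖ ≤ K` for all `0 < u ≤ 1`
then `‖∑_{N < n ≤ R} n^{−it}‖ ≤ K` (let `u → 0⁺`). This turns Theorem 2 of the source, stated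
for `0 < u ≤ 1`, into the bound for the unshifted sums used by Lemma 7.3. [folklore] -/
theorem norm_sum_Ioc_cpow_le_of_shifted {N R : ℕ} {t K : ℝ}
    (h : ∀ u : ℝ, 0 < u → u ≤ 1 → ‖∑ n ∈ Finset.Ioc N R, ((n : ℂ) + u) ^ (-(t * I))‖ ≤ K) :
    ‖∑ n ∈ Finset.Ioc N R, (n : ℂ) ^ (-(t * I))‖ ≤ K := by
  set F : ℝ → ℂ := fun u ↦ ∑ n ∈ Finset.Ioc N R, ((n : ℂ) + u) ^ (-(t * I)) with hF
  have hF0 : F 0 = ∑ n ∈ Finset.Ioc N R, (n : ℂ) ^ (-(t * I)) := by simp [hF]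
  have hcont : Filter.Tendsto (fun u ↦ ‖F u‖) (nhdsWithin 0 (Set.Ioi 0)) (nhds ‖F 0‖) :=
    ((continuousAt_sum_Ioc_cpow N R t).tendsto.mono_left nhdsWithin_le_nhds).norm
  have hev : ∀ᶠ u in nhdsWithin (0 : ℝ) (Set.Ioi 0), ‖F u‖ ≤ K := by
    filter_upwards [Ioc_mem_nhdsGT (zero_lt_one' ℝ)] with u hu
    exact h u hu.1 hu.2
  rw [← hF0]
  exact le_of_tendsto hcont hev


end FordVK

open FordVK in
/-- **Ford's Theorem 1 from Ford's Theorem 2, proved.** If, for all integers `1 ≤ N < R ≤ 2N`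
and reals `t ≥ N`, `0 < u ≤ 1`, `‖∑_{N < n ≤ R} (n + u)^{−it}‖ ≤ 9.463 N^{1 − (log N)²/(133.66 (log t)²)}`
(Theorem 2 of the source, as printed: `S(N, t) ≤ 9.463 N^{1 − 1/(133.66 λ²)}`, `λ = log t/log N`),
then `|ζ(σ + it)| ≤ 76.2 t^{4.45 (1−σ)^{3/2}} (log t)^{2/3}` for all `t ≥ 3`, `1/2 ≤ σ ≤ 1`
(`Literature.NumberTheory.LFunctions.zeta_bound_ford`, Theorem 1 of the source). "Proof of
Theorem 1: Apply Lemma 7.3 using `C = 9.463`, `D = 133.66` (from Theorem 2)"; here: the crude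
range `σ ≤ 15/16 ∨ t ≤ e^{300}` by `FordVK.zeta_bound_ford_crude`, the main range by
`FordVK.zeta_bound_ford_main_of_tail` with `FordVK.norm_zeta_sub_sum_le_one` and the hypothesis
at `u = 0` (`FordVK.norm_sum_Ioc_cpow_le_of_shifted`). The hypothesis is the only unproved
input left for `zeta_bound_ford`; it is not vendored as a named fact (D-0026).
[cite: Ford2002, Theorem 1 (proof, §7)] -/
theorem zeta_bound_ford_of_exp_sum_bound
    (hT2 : ∀ (N R : ℕ) (t u : ℝ), 1 ≤ N → (N : ℝ) ≤ t → 0 < u → u ≤ 1 → N < R → R ≤ 2 * N →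
      ‖∑ n ∈ Finset.Ioc N R, ((n : ℂ) + u) ^ (-(t * I))‖
        ≤ 9.463 * (N : ℝ) ^ (1 - Real.log N ^ 2 / (133.66 * Real.log t ^ 2))) :
    zeta_bound_ford := by
  intro σ t ht hσ hσ1
  rcases le_or_gt t (Real.exp 300) with h300 | h300
  · exact zeta_bound_ford_crude ht hσ hσ1 (Or.inr h300)
  rcases le_or_gt σ (15 / 16) with h15 | h15
  · exact zeta_bound_ford_crude ht hσ hσ1 (Or.inl h15)
  have hS : ∀ N R : ℕ, 1 ≤ N → (N : ℝ) ≤ t → N < R → R ≤ 2 * N →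
      ‖∑ n ∈ Finset.Ioc N R, (n : ℂ) ^ (-(t * I))‖
        ≤ 9.463 * (N : ℝ) ^ (1 - Real.log N ^ 2 / (133.66 * Real.log t ^ 2)) :=
    fun N R hN hNt hNR hR ↦
      norm_sum_Ioc_cpow_le_of_shifted fun u hu0 hu1 ↦ hT2 N R t u hN hNt hu0 hu1 hNR hR
  exact zeta_bound_ford_main_of_tail h15.le hσ1 h300.le
    (norm_zeta_sub_sum_le_one h15.le hσ1 h300.le) hS

end Literature.NumberTheory.LFunctions
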